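import Literature.MathematicalPhysics.QuantumFieldTheory.BalabanImbrieJaffe1984to88.BIJ88DeltaLoc234Torus

/-!
# `BalabanImbrieJaffe1984to88.BIJ88NeumannPropagatorWholeTorus` — T. Bałaban, J. Imbrie, A. Jaffe, *Renormalization of the Higgs model:
minimizers, propagators and the stability of mean field theory*, Commun. Math. Phys. **97** (1985) 299–329 [BalabanImbrieJaffe1985] = [I],
Sect. 4.6 p. 313 (4.6.1)–(4.6.4), read together with T. Bałaban, J. Imbrie, A. Jaffe, *Effective action and cluster properties of the
abelian Higgs model*, Commun. Math. Phys. **114** (1988) 257–315 [BalabanImbrieJaffe1988] p. 262–263 (2.27)/(2.34) (*"see (I.4.6.4)"*):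
**THE WHOLE-TORUS CASE `Ω = T` OF THE CONSTRUCTED NEUMANN PROPAGATOR IS [I]'s `G_k(u)` OF (4.6.2)** — the bridge between this seat's
matrix (kernel) objects `nOp`/`gBox`/`deltaRegion` (companions `BIJ88NeumannPropagator227Torus`, `BIJ88DeltaLoc234Torus`) and seat p11's
real-linear-map objects `opT (Dlin c U) (QlinK U k) a` / `∃G` / `deltaOp` / `phiCl` (`BIJ85ScalarForm464`, `BIJ85ScalarPropagatorTorusK`),
so that p11's (4.6.1)/(4.6.4)/ψ_k theorems hold WITH THE EXPLICIT PROPAGATOR, no `G`-hypothesis left.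

statement-level skeleton of published theorems with citation tags; proofs where landed; nothing here is a claim about the Yang–Mills mass gap

PDF held: `paper:balaban1985-cmp97-bij-higgs-minimizers` (journal page = PDF page + 298), p. 313 [PDF 15] as quoted verbatim in p11's
`BIJ85ScalarPropagatorTorusK`; `paper:balaban1988-cmp114-bij-abelian-higgs-effective-action` p. 262–263 [PDF 6–7] read as images this
session (renders `HOME/lit-balaban-p31/renders/original-p006/p007-x2.png`).

CITATION HEADER (lean-in-tree rule).  Part of the lit-balaban TYPED SKELETON (HOME `run/shared/lean/pub/lit-balaban/`), PHASE-2 proof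
seat p31 gen 15 (unit `lit-balaban-p31-g15`; TAKING line HOME/STATUS.md 2026-08-22T10:49:49Z, file 4 of the gen).  WHAT IS REPRODUCED:
row **C1.Eq4.6.2-4.6.4** of `HOME/lit-balaban-r15/ROWS-C1.md` (owner r15; decls of record p11's `exists_GK`/`eq461_torusK`/`eq464_torusK`/
`isMinOn_psiK_torusK`) and row **C2.Eq2.27** of `HOME/lit-balaban-r18/ROWS-C2.md` (owner r18) — kind «model instance / bridge theorems»;
two auxiliary definitions with bodies (`nLin`, `gLin`: the companion's matrices `nOp … univ`, `gBox … univ` as real-linear maps of p11's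
`ℓ²` space); no `Prop`-valued fact introduced; nothing of p11/p30/r15/r18 re-declared.

THE PRINTED TEXT (verbatim, [I] p. 313 [PDF 15]): *"exp(½⟨h, G_k(u_k)h⟩) = Z_k(u_k)^{−1}∫𝒟φ exp[−½‖D_{u_k}φ‖² − ½a_k‖Q_k(u_k)φ‖² + ⟨φ, h⟩].
(4.6.1) Since no restrictions on φ occur in the Gaussian integral (4.6.1), we can also write G_k(u_k) = [−Δ_{u_k} + a_kQ_k^*(u_k)Q_k(u_k)]^{−1},
(4.6.2) where −Δ_{u_k} = D^*_{u_k}D_{u_k}. (4.6.3) … Δ_k(u_k) = a_kI − a_k²Q_k(u_k)G_k(u_k)Q_k^*(u_k). (4.6.4) The scalar field action depends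
on the unit lattice field ψ through the η-lattice minimizer ψ_k, where ψ_k = a_kG_k(u_k)Q_k^*(u_k)ψ."*  [BalabanImbrieJaffe1988] p. 262:
*"the η-lattice propagators G_k(Ω,u) defined on subsets Ω ⊂ T_η with Neumann boundary conditions"*, p. 263: *"Here we have simply replaced
G_k(Ω,u) with G_{k,loc} in the definition of Δ_k(Ω,u); see (I.4.6.4)."*

THE MECHANISM.  (§1) p11's real inner product on `PiLp 2 (Site → ℂ)` is the real part of the Hermitian pairing: `⟪φ,ψ⟫ = Re(φᴴψ)`
(`real_inner_fine`, `real_inner_coarse`).  (§2) The companion's whole-torus operator `nOp a c U k univ` (gen-10 `hMat` with no cut-off: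
`T* =` all bonds, every `k`-block inside `T`, `1_{Tᶜ} = 0` — `cproj_univ`) as a real-linear map `nLin`; its quadratic form is p11's exponent
`‖D_uφ‖² + a‖Q_k(u)φ‖²` (`inner_nLin`, from the companion's `form_nPad` and p11's `norm_Dlin_sq`/`norm_QlinK_sub_sq`) and it is symmetric
(`nLin_symm`, `nOp` Hermitian); p11's `opT (Dlin c U) (QlinK U k) a = D^*D + aQ_k^*Q_k` has the same form (`BIJ85ScalarForm464.inner_opT`) and
is symmetric, so BY POLARIZATION **`opT (Dlin c U) (QlinK U k) a = nLin a c U k`** (`opT_eq_nLin`).  (§3) Hence EVERY right inverse `G` of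
p11's operator — the `G_k(u)` of `exists_GK` — acts as the companion's matrix: **`ofLp (G φ) = gBox a c U k univ ·φ`**
(`ofLp_G_eq_gBox_mulVec`, by `gBox_univ_mul`: `G_k(T,u)·H_T(u) = 1`), p11's `∃G` is RE-WITNESSED by the explicit `gLin` (`opT_gLin`: two-sided
inverse) and is unique (`eq_gLin`).  (§4) The real adjoint `(QlinK U k).adjoint` acts as the conjugate-transpose matrix `Q_k(u)ᴴ`
(`ofLp_adjoint_QlinK`, via `LinearMap.eq_adjoint_iff` and §1), whence **p11's `deltaOp (QlinK U k) a G` (= [I] (4.6.4)) acts as the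
companion's `deltaRegion a c U k univ`** (`ofLp_deltaOp_eq`) and p11's `phiCl` (ψ_k) as `a·G_k(T,u)Q_k(u)ᴴψ` (`ofLp_phiCl_eq`).  (§5) p11's
level-`k` theorems WITH THE EXPLICIT PROPAGATOR: `⟨ψ, Δ_k(u)ψ⟩ = Re ψᴴΔ_k(T,u)ψ` (`inner_deltaOp_eq`), `⟨h, G_kh⟩ = Re hᴴG_k(T,u)h` (`inner_G_eq`),
**(4.6.1)** `eq461_gBox`, **(4.6.4)** Gaussian form `eq464_gBox`, **ψ_k the unique minimizer** `isMinOn_psiK_gBox` — each p11's theorem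
(`eq461_torusK`, `eq464_torusK`, `isMinOn_psiK_torusK`) with `G := gLin`.

WHAT IS PROVED (0 `sorry`, standard axioms; definitions with bodies `nLin`, `gLin` + theorems; no `Prop`-valued fact).
* §1 `real_inner_fine`, `real_inner_coarse`.  §2 `ofLp_nLin`, `cproj_univ`, **`inner_nLin`**, `nLin_symm`, **`opT_eq_nLin`**.
* §3 **`ofLp_G_eq_gBox_mulVec`**, `ofLp_gLin`, **`opT_gLin`**, **`eq_gLin`**.  §4 `ofLp_QlinK`, **`ofLp_adjoint_QlinK`**, **`ofLp_deltaOp_eq`**,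
  **`ofLp_phiCl_eq`**.  §5 **`inner_deltaOp_eq`**, `inner_G_eq`, **`eq461_gBox`**, **`eq464_gBox`**, **`isMinOn_psiK_gBox`**.
HONEST SCOPE.  The whole-torus case only (p11's framework has no region `Ω`; the region propagators `G_k(Ω,u)`, `Δ_k(Ω,u)` and the localized
`G_{k,loc}`, `Δ_{k,loc}` live in the companions with their own inverse/covariance theorems); standing range `j + k ≤ m + K`, `a > 0`, `c ≠ 0`;
uniform lattice weights absorbed into `a`, `c`, `L^{−kd}` as in gen 10 / p11.  Imports: the companion `BIJ88DeltaLoc234Torus` (this seat,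
same gen; it carries p11's `BIJ85ScalarPropagatorTorusK` in its closure).  Unit `lit-balaban-p31` (literature-prover-lit-balaban-p31-g15-0),
2026-08-22.  NOT summit progress.
-/

open scoped BigOperators Matrix ComplexConjugate RealInnerProductSpace
open Finset Matrix

namespace Literature.MathematicalPhysics.QuantumFieldTheory.BalabanImbrieJaffe1984to88.BIJ88NeumannPropagatorWholeTorus

open Literature.MathematicalPhysics.QuantumFieldTheory.Balaban1983to89
open BIJ88Sect3Statements (U1 toC cfg covD starB mem_starB)
open BIJ85BlockAveragesTorus BIJ85BlockAveragesTorusK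
open BIJ85ScalarPropagatorTorus (FineSp BondSp Dlin Dlin_apply norm_Dlin_sq)
open BIJ85ScalarForm464 (opT inner_opT opT_symm deltaOp phiCl scalarForm)
open BIJ85ScalarPropagatorTorusK (eq461_torusK eq464_torusK isMinOn_psiK_torusK)
open BIJ88NeumannNoZeroModesTorus BIJ88NeumannPropagator227Torus BIJ88DeltaLoc234Torus

noncomputable section

variable {P : Params} {j : ℕ}

/-! ## §1 The real inner product of p11's field spaces as the real part of the Hermitian pairing -/

/-- kernel: `⟪φ, ψ⟫ = Re(φᴴψ)` on the `η`-lattice field space. [cite: BalabanImbrieJaffe1985, (2.2) p.302] -/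
theorem real_inner_fine (φ ψ : FineSp P j) : ⟪φ, ψ⟫ = (star (WithLp.ofLp φ) ⬝ᵥ WithLp.ofLp ψ).re := by
  rw [PiLp.inner_apply, dotProduct, Complex.re_sum]
  refine Finset.sum_congr rfl fun x _ => ?_
  rw [Complex.inner, Pi.star_apply, Complex.star_def, mul_comm]

/-- kernel: `⟪ψ, ψ′⟫ = Re(ψᴴψ′)` on the unit-lattice field space. [cite: BalabanImbrieJaffe1985, (2.2) p.302] -/
theorem real_inner_coarse {k : ℕ} (ψ ψ' : CoarseSpK P j k) : ⟪ψ, ψ'⟫ = (star (WithLp.ofLp ψ) ⬝ᵥ WithLp.ofLp ψ').re := by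
  rw [PiLp.inner_apply, dotProduct, Complex.re_sum]
  refine Finset.sum_congr rfl fun x _ => ?_
  rw [Complex.inner, Pi.star_apply, Complex.star_def, mul_comm]

/-! ## §2 The whole-torus Neumann operator as a real-linear map of p11's `ℓ²` space -/

/-- `H_T(u) = −Δ_u + a_kQ_k^*(u)Q_k(u)` on the WHOLE torus (`Ω = T`, no boundary: the companion's `nOp a c U k univ`) as a real-linear
map of p11's `FineSp`. [cite: BalabanImbrieJaffe1985, (4.6.2) p.313] -/
def nLin (a c : ℝ) (U : GaugeField P j U1) (k : ℕ) : FineSp P j →ₗ[ℝ] FineSp P j where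
  toFun φ := WithLp.toLp 2 (nOp a c U k univ *ᵥ WithLp.ofLp φ)
  map_add' φ φ' := by
    rw [WithLp.ofLp_add, mulVec_add]; rfl
  map_smul' r φ := by
    rw [WithLp.ofLp_smul, mulVec_smul]; rfl

/-- kernel: the underlying vector of `nLin φ`. [cite: BalabanImbrieJaffe1985, (4.6.2) p.313] -/
theorem ofLp_nLin (a c : ℝ) (U : GaugeField P j U1) (k : ℕ) (φ : FineSp P j) :
    WithLp.ofLp (nLin a c U k φ) = nOp a c U k univ *ᵥ WithLp.ofLp φ := rfl

/-- kernel: `(1_{Tᶜ}) = 0`, `T* = all bonds`, every `k`-block is inside `T`. [cite: BalabanImbrieJaffe1988, (2.27) p.263] -/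
theorem cproj_univ : cproj (univ : Finset (Balaban1983to89.Site P j)) = 0 := by
  unfold cproj; rw [← diagonal_zero]; congr 1; funext x; simp

/-- **The quadratic form of the whole-torus operator IS the exponent of [I] (4.6.1)**: `⟪φ, H_T(u)φ⟫ = ‖D_uφ‖² + a‖Q_k(u)φ‖²` with p11's
`Dlin`, `QlinK` (the companion's `form_nPad` at `Ω = T`). [cite: BalabanImbrieJaffe1985, (4.6.1) p.313] -/
theorem inner_nLin (a c : ℝ) (U : GaugeField P j U1) (k : ℕ) (φ : FineSp P j) :
    ⟪φ, nLin a c U k φ⟫ = ‖Dlin c U φ‖ ^ 2 + a * ‖QlinK U k φ‖ ^ 2 := by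
  rw [real_inner_fine, ofLp_nLin]
  have h := form_nPad a c U k univ (WithLp.ofLp φ)
  rw [nPad, cproj_univ, add_zero] at h
  rw [h, Complex.ofReal_re, norm_Dlin_sq, ← sub_zero (QlinK U k φ), norm_QlinK_sub_sq]
  have h1 : starB (univ : Finset (Balaban1983to89.Site P j)) = univ := by
    ext b; simp [mem_starB]
  have h2 : innerK k (univ : Finset (Balaban1983to89.Site P j)) = univ := by
    ext y; simp [mem_innerK]
  rw [h1, h2, Finset.compl_univ, Finset.sum_empty, add_zero, WithLp.ofLp_zero]
  simp only [Pi.zero_apply, sub_zero]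
  rfl

/-- kernel: `H_T(u)` is symmetric for `⟪·,·⟫` (it is Hermitian). [cite: BalabanImbrieJaffe1985, (4.6.2) p.313] -/
theorem nLin_symm (a c : ℝ) (U : GaugeField P j U1) (k : ℕ) (φ ψ : FineSp P j) :
    ⟪nLin a c U k φ, ψ⟫ = ⟪φ, nLin a c U k ψ⟫ := by
  rw [real_inner_fine, real_inner_fine, ofLp_nLin, ofLp_nLin, star_mulVec, ← dotProduct_mulVec, nOp_conjTranspose]

/-- kernel: two symmetric real-linear operators with the same quadratic form are equal (polarization). [cite: BalabanImbrieJaffe1985, (4.6.2) p.313] -/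
private theorem eq_of_inner_self_eq {E : Type*} [NormedAddCommGroup E] [InnerProductSpace ℝ E] {S T : E →ₗ[ℝ] E}
    (hS : ∀ x y, ⟪S x, y⟫ = ⟪x, S y⟫) (hT : ∀ x y, ⟪T x, y⟫ = ⟪x, T y⟫) (h : ∀ x, ⟪x, S x⟫ = ⟪x, T x⟫) : S = T := by
  have key : ∀ x y, ⟪x, S y⟫ = ⟪x, T y⟫ := by
    intro x y
    have hx := h x
    have hy := h y
    have hxy := h (x + y)
    have e1 : ⟪y, S x⟫ = ⟪x, S y⟫ := by rw [← hS, real_inner_comm]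
    have e2 : ⟪y, T x⟫ = ⟪x, T y⟫ := by rw [← hT, real_inner_comm]
    simp only [map_add, inner_add_left, inner_add_right, e1, e2, hx, hy] at hxy
    linarith
  ext y
  exact ext_inner_left ℝ fun x => key x y

/-- **p11's operator of (4.6.2) IS the whole-torus Neumann operator**: `opT (Dlin c U) (QlinK U k) a = nLin a c U k` — [I]'s
`D_u^*D_u + a_kQ_k^*Q_k` (real adjoints on `ℓ²`, `BIJ85ScalarForm464.opT`) and this seat's matrix `H_T(u)` (my gen-10 `hMat` with no
cut-off) coincide (same quadratic form, both symmetric). [cite: BalabanImbrieJaffe1985, (4.6.2) p.313] -/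
theorem opT_eq_nLin (a c : ℝ) (U : GaugeField P j U1) (k : ℕ) : opT (Dlin c U) (QlinK U k) a = nLin a c U k :=
  eq_of_inner_self_eq (opT_symm (D := Dlin c U) (Q := QlinK U k) (a := a)) (nLin_symm a c U k) fun φ => by
    rw [inner_opT, inner_nLin]

/-! ## §3 `G_k(u)` of [I] (4.6.2) = the constructed `G_k(T,u)`; p11's existence statement re-witnessed -/

section Inverse

variable {k : ℕ} {a c : ℝ}

/-- **EVERY right inverse `G` of p11's operator (the `G_k(u)` of `BIJ85ScalarPropagatorTorusK.exists_GK`) ACTS AS the constructed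
matrix `G_k(T,u) = gBox a c U k univ`** (standing range, `a > 0`, `c ≠ 0`). [cite: BalabanImbrieJaffe1985, (4.6.2) p.313] -/
theorem ofLp_G_eq_gBox_mulVec (hk : j + k ≤ P.m + P.K) (hc : c ≠ 0) (ha : 0 < a) (U : GaugeField P j U1)
    {G : FineSp P j →ₗ[ℝ] FineSp P j} (hG : ∀ φ, opT (Dlin c U) (QlinK U k) a (G φ) = φ) (φ : FineSp P j) :
    WithLp.ofLp (G φ) = gBox a c U k univ *ᵥ WithLp.ofLp φ := by
  have h1 : nOp a c U k univ *ᵥ WithLp.ofLp (G φ) = WithLp.ofLp φ := by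
    rw [← ofLp_nLin, ← opT_eq_nLin, hG]
  rw [← h1, mulVec_mulVec, (gBox_univ_mul hk hc ha U).1, one_mulVec]

/-- **`G_k(T,u)` as a real-linear map of p11's space**: `φ ↦ gBox·φ`. [cite: BalabanImbrieJaffe1985, (4.6.2) p.313] -/
def gLin (a c : ℝ) (U : GaugeField P j U1) (k : ℕ) : FineSp P j →ₗ[ℝ] FineSp P j where
  toFun φ := WithLp.toLp 2 (gBox a c U k univ *ᵥ WithLp.ofLp φ)
  map_add' φ φ' := by
    rw [WithLp.ofLp_add, mulVec_add]; rfl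
  map_smul' r φ := by
    rw [WithLp.ofLp_smul, mulVec_smul]; rfl

/-- kernel: the underlying vector of `gLin φ`. [cite: BalabanImbrieJaffe1985, (4.6.2) p.313] -/
theorem ofLp_gLin (a c : ℝ) (U : GaugeField P j U1) (k : ℕ) (φ : FineSp P j) :
    WithLp.ofLp (gLin a c U k φ) = gBox a c U k univ *ᵥ WithLp.ofLp φ := rfl

/-- **`G_k(T,u)` IS A TWO-SIDED INVERSE of p11's operator** — the existence statement `BIJ85ScalarPropagatorTorusK.exists_GK` ((4.6.2) on
the torus) re-witnessed by the EXPLICIT matrix of the companion file. [cite: BalabanImbrieJaffe1985, (4.6.2) p.313] -/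
theorem opT_gLin (hk : j + k ≤ P.m + P.K) (hc : c ≠ 0) (ha : 0 < a) (U : GaugeField P j U1) (φ : FineSp P j) :
    opT (Dlin c U) (QlinK U k) a (gLin a c U k φ) = φ ∧ gLin a c U k (opT (Dlin c U) (QlinK U k) a φ) = φ := by
  have hm := gBox_univ_mul hk hc ha U
  rw [opT_eq_nLin]
  constructor
  · apply WithLp.ofLp_injective 2
    rw [ofLp_nLin, ofLp_gLin, mulVec_mulVec, hm.2, one_mulVec]
  · apply WithLp.ofLp_injective 2
    rw [ofLp_gLin, ofLp_nLin, mulVec_mulVec, hm.1, one_mulVec]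

/-- kernel: p11's inverse is unique and equals `gLin`. [cite: BalabanImbrieJaffe1985, (4.6.2) p.313] -/
theorem eq_gLin (hk : j + k ≤ P.m + P.K) (hc : c ≠ 0) (ha : 0 < a) (U : GaugeField P j U1) {G : FineSp P j →ₗ[ℝ] FineSp P j}
    (hG : ∀ φ, opT (Dlin c U) (QlinK U k) a (G φ) = φ) : G = gLin a c U k :=
  LinearMap.ext fun φ => WithLp.ofLp_injective 2 (ofLp_G_eq_gBox_mulVec hk hc ha U hG φ)

end Inverse

/-! ## §4 The adjoint `Q_k^*(u)` and `Δ_k(u)` of [I] (4.6.4) = the constructed `Δ_k(T,u)` -/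

section Delta

variable {k : ℕ} {a c : ℝ}

/-- kernel: `ofLp (Q_k(u)φ) = Q_k(u)·φ` (p11's `QlinK` acts as the matrix `qMatT`). [cite: BalabanImbrieJaffe1985, (4.6.1) p.313] -/
theorem ofLp_QlinK (U : GaugeField P j U1) (k : ℕ) (φ : FineSp P j) : WithLp.ofLp (QlinK U k φ) = qMatT U k *ᵥ WithLp.ofLp φ := by
  funext y
  rw [qMatT_mulVec]
  rfl

/-- **The real adjoint `Q_k^*(u)` of p11's `QlinK` acts as the conjugate-transpose matrix `Q_k(u)ᴴ`** — the `Q_k^*` of (4.6.4)/(2.34).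
[cite: BalabanImbrieJaffe1985, (4.6.4) p.313] -/
theorem ofLp_adjoint_QlinK (U : GaugeField P j U1) (k : ℕ) (ψ : CoarseSpK P j k) :
    WithLp.ofLp ((QlinK U k).adjoint ψ) = (qMatT U k)ᴴ *ᵥ WithLp.ofLp ψ := by
  let A : CoarseSpK P j k →ₗ[ℝ] FineSp P j :=
    { toFun := fun ψ => WithLp.toLp 2 ((qMatT U k)ᴴ *ᵥ WithLp.ofLp ψ)
      map_add' := fun ψ ψ' => by rw [WithLp.ofLp_add, mulVec_add]; rfl
      map_smul' := fun r ψ => by rw [WithLp.ofLp_smul, mulVec_smul]; rfl }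
  have hA : A = (QlinK U k).adjoint := by
    rw [LinearMap.eq_adjoint_iff]
    intro ψ φ
    rw [real_inner_fine, real_inner_coarse, ofLp_QlinK]
    show (star ((qMatT U k)ᴴ *ᵥ WithLp.ofLp ψ) ⬝ᵥ WithLp.ofLp φ).re = _
    rw [star_mulVec, conjTranspose_conjTranspose, ← dotProduct_mulVec]
  have := congrArg (fun B => WithLp.ofLp (B ψ)) hA
  exact this.symm

/-- **[I] (4.6.4) `Δ_k(u_k) = a_kI − a_k²Q_kG_kQ_k^*` (p11's `deltaOp` with p11's `G_k(u)`) ACTS AS the constructed `Δ_k(T,u)`** (the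
companion's `deltaRegion a c U k univ`) — (2.34)'s *"see (I.4.6.4)"* made literal on the torus. [cite: BalabanImbrieJaffe1988, (2.34) p.263] -/
theorem ofLp_deltaOp_eq (hk : j + k ≤ P.m + P.K) (hc : c ≠ 0) (ha : 0 < a) (U : GaugeField P j U1)
    {G : FineSp P j →ₗ[ℝ] FineSp P j} (hG : ∀ φ, opT (Dlin c U) (QlinK U k) a (G φ) = φ) (ψ : CoarseSpK P j k) :
    WithLp.ofLp (deltaOp (QlinK U k) a G ψ) = deltaRegion a c U k univ *ᵥ WithLp.ofLp ψ := by
  rw [deltaOp, LinearMap.sub_apply, LinearMap.smul_apply, LinearMap.smul_apply, LinearMap.id_apply, LinearMap.comp_apply,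
    LinearMap.comp_apply, WithLp.ofLp_sub, WithLp.ofLp_smul, WithLp.ofLp_smul, ofLp_QlinK, ofLp_G_eq_gBox_mulVec hk hc ha U hG,
    ofLp_adjoint_QlinK, deltaRegion, sub_mulVec, smul_mulVec, smul_mulVec, one_mulVec, mulVec_mulVec, mulVec_mulVec]
  funext y
  simp only [Pi.sub_apply, Pi.smul_apply, Complex.real_smul, smul_eq_mul, Complex.ofReal_pow]

/-- **The minimizer `ψ_k = a_kG_kQ_k^*ψ` of [I] p. 313 (p11's `phiCl`) ACTS AS `a·G_k(T,u)Q_k(u)ᴴψ`** — the (4.12) shape with the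
whole-torus propagator. [cite: BalabanImbrieJaffe1985, (4.6.4) p.313] -/
theorem ofLp_phiCl_eq (hk : j + k ≤ P.m + P.K) (hc : c ≠ 0) (ha : 0 < a) (U : GaugeField P j U1)
    {G : FineSp P j →ₗ[ℝ] FineSp P j} (hG : ∀ φ, opT (Dlin c U) (QlinK U k) a (G φ) = φ) (ψ : CoarseSpK P j k) :
    WithLp.ofLp (phiCl (QlinK U k) a G ψ) = (a : ℂ) • ((gBox a c U k univ * (qMatT U k)ᴴ) *ᵥ WithLp.ofLp ψ) := by
  rw [phiCl, WithLp.ofLp_smul, ofLp_G_eq_gBox_mulVec hk hc ha U hG, ofLp_adjoint_QlinK, mulVec_mulVec]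
  funext x
  simp only [Pi.smul_apply, Complex.real_smul, smul_eq_mul]

end Delta

/-! ## §5 [I] (4.6.1)/(4.6.4) on the torus with THE EXPLICIT propagator: p11's `G`-hypotheses discharged by `gLin` -/

section Explicit

variable {k : ℕ} {a c : ℝ}

/-- kernel: **`⟨ψ, Δ_k(u)ψ⟩ = Re(ψᴴ·Δ_k(T,u)·ψ)`** — p11's real pairing of (4.6.4) (any right inverse `G`) IS the Hermitian form of the
constructed kernel `deltaRegion a c U k univ`. [cite: BalabanImbrieJaffe1985, (4.6.4) p.313] -/
theorem inner_deltaOp_eq (hk : j + k ≤ P.m + P.K) (hc : c ≠ 0) (ha : 0 < a) (U : GaugeField P j U1)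
    {G : FineSp P j →ₗ[ℝ] FineSp P j} (hG : ∀ φ, opT (Dlin c U) (QlinK U k) a (G φ) = φ) (ψ : CoarseSpK P j k) :
    ⟪ψ, deltaOp (QlinK U k) a G ψ⟫ = (star (WithLp.ofLp ψ) ⬝ᵥ (deltaRegion a c U k univ *ᵥ WithLp.ofLp ψ)).re := by
  rw [real_inner_coarse, ofLp_deltaOp_eq hk hc ha U hG]

/-- kernel: `⟨h, G_k(u)h⟩ = Re(hᴴ·G_k(T,u)·h)` for any right inverse `G` of p11's operator. [cite: BalabanImbrieJaffe1985, (4.6.2) p.313] -/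
theorem inner_G_eq (hk : j + k ≤ P.m + P.K) (hc : c ≠ 0) (ha : 0 < a) (U : GaugeField P j U1)
    {G : FineSp P j →ₗ[ℝ] FineSp P j} (hG : ∀ φ, opT (Dlin c U) (QlinK U k) a (G φ) = φ) (h : FineSp P j) :
    ⟪h, G h⟫ = (star (WithLp.ofLp h) ⬝ᵥ (gBox a c U k univ *ᵥ WithLp.ofLp h)).re := by
  rw [real_inner_fine, ofLp_G_eq_gBox_mulVec hk hc ha U hG]

/-- **[I] (4.6.1) on the torus with the EXPLICIT propagator, no hypothesis left**: `exp(½ Re hᴴG_k(T,u)h) = Z_k(u)^{−1}∫𝒟φ exp[−½‖D_uφ‖² −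
½a‖Q_k(u)φ‖² + ⟨φ,h⟩]` — p11's `eq461_torusK` with its right inverse `G` := `gLin` (the matrix `gBox a c U k univ`).
[cite: BalabanImbrieJaffe1985, (4.6.1) p.313] -/
theorem eq461_gBox (hk : j + k ≤ P.m + P.K) (hc : c ≠ 0) (ha : 0 < a) (U : GaugeField P j U1) (h : FineSp P j) :
    Real.exp ((1 / 2 : ℝ) * (star (WithLp.ofLp h) ⬝ᵥ (gBox a c U k univ *ᵥ WithLp.ofLp h)).re)
      = (∫ φ : FineSp P j, Real.exp (-(1 / 2 : ℝ) * ‖Dlin c U φ‖ ^ 2 - (1 / 2 : ℝ) * a * ‖QlinK U k φ‖ ^ 2))⁻¹ *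
        ∫ φ : FineSp P j, Real.exp (-(1 / 2 : ℝ) * ‖Dlin c U φ‖ ^ 2 - (1 / 2 : ℝ) * a * ‖QlinK U k φ‖ ^ 2 + ⟪φ, h⟫) := by
  have hG : ∀ φ, opT (Dlin c U) (QlinK U k) a (gLin a c U k φ) = φ := fun φ => (opT_gLin hk hc ha U φ).1
  rw [← inner_G_eq hk hc ha U hG]
  exact eq461_torusK hk hc ha U (gLin a c U k) hG h

/-- **[I] (4.6.4) on the torus, Gaussian form, with the EXPLICIT `Δ_k(T,u)`**: `∫𝒟φ exp[−½aΣ_y|(Q_k(u)φ)(y) − ψ(y)|² − ½Σ_b|c(u_bφ(b₊) −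
φ(b₋))|²] = exp(−½ Re ψᴴΔ_k(T,u)ψ)·∫𝒟φ exp[−½(‖D_uφ‖² + a‖Q_k(u)φ‖²)]` — p11's `eq464_torusK` with `G := gLin` and the exponent read
through `inner_deltaOp_eq`. [cite: BalabanImbrieJaffe1985, (4.6.4) p.313] -/
theorem eq464_gBox (hk : j + k ≤ P.m + P.K) (hc : c ≠ 0) (ha : 0 < a) (U : GaugeField P j U1) (ψ : CoarseSpK P j k) :
    ∫ φ : FineSp P j, Real.exp (-((1 / 2 : ℝ) * a * (∑ y : Balaban1983to89.Site P (j+k), ‖qCovK U k (WithLp.ofLp φ) y - ψ y‖ ^ 2)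
        + (1 / 2 : ℝ) * ∑ b : PBond P j, ‖(c : ℂ) * (toC (U b) * φ b.tgt - φ b.src)‖ ^ 2))
      = Real.exp (-((1 / 2 : ℝ) * (star (WithLp.ofLp ψ) ⬝ᵥ (deltaRegion a c U k univ *ᵥ WithLp.ofLp ψ)).re))
        * ∫ φ : FineSp P j, Real.exp (-((1 / 2 : ℝ) * (‖Dlin c U φ‖ ^ 2 + a * ‖QlinK U k φ‖ ^ 2))) := by
  have hG : ∀ φ, opT (Dlin c U) (QlinK U k) a (gLin a c U k φ) = φ := fun φ => (opT_gLin hk hc ha U φ).1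
  rw [← inner_deltaOp_eq hk hc ha U hG]
  simp_rw [← inner_opT (D := Dlin c U) (Q := QlinK U k) (a := a)]
  exact eq464_torusK c a U k hG ψ

/-- **p. 313's minimizer with a body**: `ψ_k = a_kG_k(T,u)Q_k(u)ᴴψ` (the vector `a·(gBox·Q_kᴴ)·ψ`) minimizes the printed form ½aΣ|Q_k(u)φ − ψ|² +
½Σ|D_uφ|² over all `φ` and is its only minimizer — p11's `isMinOn_psiK_torusK` with `G := gLin`. [cite: BalabanImbrieJaffe1985, (4.6.4) p.313] -/
theorem isMinOn_psiK_gBox (hk : j + k ≤ P.m + P.K) (hc : c ≠ 0) (ha : 0 < a) (U : GaugeField P j U1) (ψ : CoarseSpK P j k) :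
    IsMinOn (scalarForm (Dlin c U) (QlinK U k) a ψ) Set.univ
        (WithLp.toLp 2 ((a : ℂ) • ((gBox a c U k univ * (qMatT U k)ᴴ) *ᵥ WithLp.ofLp ψ)) : FineSp P j) ∧
      ∀ φ, IsMinOn (scalarForm (Dlin c U) (QlinK U k) a ψ) Set.univ φ →
        φ = WithLp.toLp 2 ((a : ℂ) • ((gBox a c U k univ * (qMatT U k)ᴴ) *ᵥ WithLp.ofLp ψ)) := by
  have hG : ∀ φ, opT (Dlin c U) (QlinK U k) a (gLin a c U k φ) = φ := fun φ => (opT_gLin hk hc ha U φ).1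
  have e : phiCl (QlinK U k) a (gLin a c U k) ψ
      = WithLp.toLp 2 ((a : ℂ) • ((gBox a c U k univ * (qMatT U k)ᴴ) *ᵥ WithLp.ofLp ψ)) :=
    WithLp.ofLp_injective 2 (ofLp_phiCl_eq hk hc ha U hG ψ)
  rw [← e]
  exact isMinOn_psiK_torusK hk hc ha U hG ψ

end Explicit

end

end Literature.MathematicalPhysics.QuantumFieldTheory.BalabanImbrieJaffe1984to88.BIJ88NeumannPropagatorWholeTorus
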